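import Summits.ValiantsHypothesis.ValiantsHypothesis.Theorems.BarrierLeverDefinableEquationsLinearRankTemplate
import Literature.Computability.AlgebraicComplexity.DeterminantalComplexityProofs

/-!
# Route BarrierLever — TEMPLATE, second half (part 2/2): the technique class "rank of a
# `poly(N)`-size matrix of affine forms in the coefficients" IS the class of `poly(N)`-size
# DETERMINANTAL distinguishers, and Question 6 (crux 14610) saturates it
# (crux `DefinableEquations` stmt-8745 / item `SingleSizeEquations` stmt-8749; val-np-p5 g11)

Continuation of `…LinearRankTemplate.lean`.

* `eq_C_add_sum_of_totalDegree_le_one`, `complexity_le_of_totalDegree_le_one` (an affine form in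
  the `N` coefficient variables costs `≤ 2N+1`), `complexity_le_of_isAffineDetRepr`,
  `mem_distinguishers_of_hasDetRepr` / `mem_distinguishers_of_dc_le` (a polynomial in the
  coefficient variables with an affine determinantal representation of size `s`,
  `8(s+1)^7 + s²(2N+1) ≤ N^a`, is a level-`a` distinguisher — Berkowitz; so every minor of an
  affine rank method is such a distinguisher and conversely, by definition of `dc`, every
  distinguisher of `dc ≤ s` is "the rank of an `s × s` affine matrix drops");
* **`isSuccinctHittingSet_detRepr_of_succinct`**: under FSV Question 6 = the route's rank-2 crux
  `SuccinctHittingSetsForVP` (stmt-14610), for every level `a` there are `b, n₀` such that for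
  `n ≥ n₀` NO nonzero distinguisher of determinantal complexity `≤ N^a` — equivalently no affine
  rank method of size `≤ N^a` (shifted partials of any order, Young flattenings, Ruppert
  matrices, …) — vanishes on `coeff(SmallCircuits ℂ n b)`.  The g10 method walls (PD, shifted PD of
  high order, full rank, LST, Kalorkoti, unions) are UNCONDITIONAL instances with explicit small `b`;
  every future wall for a linear rank method is an instance of this conditional statement;
* **`not_succinct_of_affineRankMethod`** (contrapositive): ONE affine rank method that works at a
  FIXED level against EVERY size exponent `b` refutes the crux (a gap for ONE `b` — all that item
  8749 asks — is compatible with Question 6).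

WHAT THIS IS NOT: CONDITIONAL on Question 6 where said, and not a restatement of it (only the
unfolding "dc ≤ N^a ⟹ size ≤ N^{9a+11}" is added); nothing on the crux's verdict or on `VP ≠ VNP`.
No definitions, no named facts; standard axioms.
-/

-- `Summit.ValiantsHypothesis.ValiantsHypothesis.…` repeats a component by the D-0017 layout
-- (single-conjunct summit), which the `dupNamespace` linter flags; the name is mandated.
set_option linter.dupNamespace false

noncomputable section

namespace Summit.ValiantsHypothesis.ValiantsHypothesis.Theorems.BarrierLeverDefinableEquations

open MvPolynomial
open Literature.Computability.AlgebraicComplexity Literature.Barriers.ValiantsHypothesis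
open scoped BigOperators

namespace LinearRankTemplate

variable {n R S r : ℕ}

/-! ## §3 The technique class as a distinguisher class: determinantal distinguishers, and their
saturation under Question 6 -/

/-- An affine form (total degree `≤ 1`) in the `N` coefficient variables is `C(constant
coefficient) + Σ_m a_m • X m`. [folklore] -/
theorem eq_C_add_sum_of_totalDegree_le_one
    {p : MvPolynomial ↥(degLEMonomials n) ℂ} (hp : p.totalDegree ≤ 1) :
    p = C (coeff 0 p) + ∑ m, coeff (Finsupp.single m 1) p • X m := by
  classical
  apply MvPolynomial.ext
  intro d
  rw [coeff_add, coeff_C, coeff_sum]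
  simp only [coeff_smul, coeff_X, smul_eq_mul, mul_ite, mul_one, mul_zero]
  by_cases hd0 : d = 0
  · subst hd0
    simp [Finsupp.single_eq_zero]
  · rw [if_neg (Ne.symm hd0), zero_add]
    by_cases hdeg1 : d.degree ≤ 1
    · -- `d ≠ 0` of degree `≤ 1` is a `single m 1`
      have hd1 : d.degree = 1 := by
        have : d.degree ≠ 0 := fun h => hd0 ((Finsupp.degree_eq_zero_iff d).mp h)
        omega
      obtain ⟨m, hm⟩ : ∃ m, d = Finsupp.single m 1 := by
        have hne : d.support.Nonempty := Finsupp.support_nonempty_iff.mpr hd0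
        obtain ⟨m, hm⟩ := hne
        refine ⟨m, ?_⟩
        have hdm : d m = 1 := by
          have h1 : d m ≤ d.degree := Finsupp.le_degree m d
          have h2 : 0 < d m := Nat.pos_of_ne_zero (Finsupp.mem_support_iff.mp hm)
          omega
        ext m'
        by_cases hmm : m' = m
        · subst hmm; simp [hdm]
        · have hs0 : (Finsupp.single m 1 : ↥(degLEMonomials n) →₀ ℕ) m' = 0 := by
            rw [Finsupp.single_apply, if_neg (Ne.symm hmm)]
          rw [hs0]
          by_contra hne'
          have h3 : d m + d m' ≤ d.degree := by
            rw [Finsupp.degree, ← Finset.sum_pair (Ne.symm hmm)]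
            exact Finset.sum_le_sum_of_subset (by
              intro x hx
              simp only [Finset.mem_insert, Finset.mem_singleton] at hx
              rcases hx with rfl | rfl
              · exact hm
              · exact Finsupp.mem_support_iff.mpr hne')
          have h4 : 0 < d m' := Nat.pos_of_ne_zero hne'
          omega
      subst hm
      rw [Finset.sum_eq_single m]
      · simp
      · intro m' _ hne
        rw [if_neg]
        intro h
        exact hne ((Finsupp.single_left_injective one_ne_zero) h)
      · intro h; exact absurd (Finset.mem_univ m) h
    · -- degree ≥ 2: coefficient of `p` vanishes, and no `single m 1` equals `d`
      have hc : coeff d p = 0 := by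
        by_contra hne
        have : d.degree ≤ p.totalDegree := by
          have := le_totalDegree (mem_support_iff.mpr hne)
          simpa [Finsupp.degree, Finsupp.sum] using this
        omega
      rw [hc]
      symm
      refine Finset.sum_eq_zero fun m _ => ?_
      rw [if_neg]
      intro h
      apply hdeg1
      rw [← h, Finsupp.degree_single]

/-- An affine form in the `N` coefficient variables has complexity `≤ 2N + 1`. [folklore] -/
theorem complexity_le_of_totalDegree_le_one
    {p : MvPolynomial ↥(degLEMonomials n) ℂ} (hp : p.totalDegree ≤ 1) :
    complexity p ≤ 2 * Fintype.card ↥(degLEMonomials n) + 1 := by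
  classical
  have hlin : (∑ m, coeff (Finsupp.single m 1) p • X m : MvPolynomial ↥(degLEMonomials n) ℂ) ∈
      BarrierLever.NaturalProofsAgainstAllLinearSizes.linSpan n :=
    Submodule.sum_mem _ fun m _ => Submodule.smul_mem _ _
      (BarrierLever.NaturalProofsAgainstAllLinearSizes.X_mem_linSpan m)
  have h1 := BarrierLever.NaturalProofsAgainstAllLinearSizes.complexity_le_of_mem_linSpan hlin
  rw [eq_C_add_sum_of_totalDegree_le_one hp]
  calc complexity (C (coeff 0 p) + ∑ m, coeff (Finsupp.single m 1) p • X m)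
      ≤ complexity (C (coeff 0 p) : MvPolynomial ↥(degLEMonomials n) ℂ) +
          complexity (∑ m, coeff (Finsupp.single m 1) p • X m : MvPolynomial ↥(degLEMonomials n) ℂ)
          + 1 := complexity_add_le_holds _ _
    _ ≤ 0 + 2 * Fintype.card ↥(degLEMonomials n) + 1 := by
        rw [complexity_C_holds]
        exact Nat.add_le_add_right (Nat.add_le_add_left h1 _) _
    _ = 2 * Fintype.card ↥(degLEMonomials n) + 1 := by rw [zero_add]

/-- A polynomial in the coefficient variables with an affine determinantal representation of
size `s` has complexity `≤ 8(s+1)^7 + s²(2N+1)` (Berkowitz) and degree `≤ s`. [folklore] -/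
theorem complexity_le_of_isAffineDetRepr {s : ℕ}
    {D : MvPolynomial ↥(degLEMonomials n) ℂ} {A : Matrix (Fin s) (Fin s) (MvPolynomial ↥(degLEMonomials n) ℂ)}
    (hA : IsAffineDetRepr D A) :
    complexity D ≤ 8 * (s + 1) ^ 7 + s ^ 2 * (2 * Fintype.card ↥(degLEMonomials n) + 1) ∧
      D.totalDegree ≤ s := by
  obtain ⟨hdeg, hdet⟩ := hA
  constructor
  · have h := BarrierLever.NaturalProofsAgainstAllLinearSizes.complexity_det_le A
      (2 * Fintype.card ↥(degLEMonomials n) + 1) (fun i j => complexity_le_of_totalDegree_le_one (hdeg i j))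
    rw [← hdet]; simpa [Fintype.card_fin] using h
  · have h := BarrierLever.NaturalProofsAgainstAllLinearSizes.totalDegree_det_le_card A hdeg
    rw [← hdet]; simpa [Fintype.card_fin] using h

/-- **Determinantal distinguishers are distinguishers**: if `D` has an affine determinantal
representation of size `s` with `8(s+1)^7 + s²(2N+1) ≤ N^a` then `D ∈ Distinguishers ℂ n a`.
[cite: ForbesShpilkaVolk2018, Cor. 5] -/
theorem mem_distinguishers_of_hasDetRepr {s a : ℕ}
    {D : MvPolynomial ↥(degLEMonomials n) ℂ} (hD : HasDetRepr D s)
    (hs : 8 * (s + 1) ^ 7 + s ^ 2 * (2 * Fintype.card ↥(degLEMonomials n) + 1) ≤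
      Nat.choose (2 * n) n ^ a) :
    D ∈ Distinguishers ℂ n a := by
  obtain ⟨A, hA⟩ := hD
  obtain ⟨h1, h2⟩ := complexity_le_of_isAffineDetRepr hA
  refine ⟨h1.trans hs, h2.trans (le_trans ?_ hs)⟩
  calc s ≤ s + 1 := Nat.le_succ s
    _ ≤ (s + 1) ^ 7 := Nat.le_self_pow (by norm_num) _
    _ ≤ 8 * (s + 1) ^ 7 := Nat.le_mul_of_pos_left _ (by norm_num)
    _ ≤ _ := Nat.le_add_right _ _

/-- The same with the tree's determinantal complexity `dc D ≤ s` (the infimum is attained: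
Valiant's universality, tree `hasDetRepr_iff_determinantalComplexity_le_holds`).
[cite: ForbesShpilkaVolk2018, Cor. 5] -/
theorem mem_distinguishers_of_dc_le {s a : ℕ}
    {D : MvPolynomial ↥(degLEMonomials n) ℂ} (hD : determinantalComplexity D ≤ s)
    (hs : 8 * (s + 1) ^ 7 + s ^ 2 * (2 * Fintype.card ↥(degLEMonomials n) + 1) ≤
      Nat.choose (2 * n) n ^ a) :
    D ∈ Distinguishers ℂ n a :=
  mem_distinguishers_of_hasDetRepr
    ((hasDetRepr_iff_determinantalComplexity_le_holds D s).mpr hD) hs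

/-- Arithmetic: `8(s+1)^7 + s²(2N+1) ≤ N^{7(a+1)+2a+2}`... we use the crude form: for
`s ≤ N^a` and `1 ≤ N`, `8(s+1)^7 + s²(2N+1) ≤ N^{9a + 11}`. [folklore] -/
theorem size_arith {N s a : ℕ} (hN : 2 ≤ N) (hs : s ≤ N ^ a) :
    8 * (s + 1) ^ 7 + s ^ 2 * (2 * N + 1) ≤ N ^ (9 * a + 11) := by
  have h1 : s + 1 ≤ N ^ (a + 1) := by
    calc s + 1 ≤ N ^ a + N ^ a := Nat.add_le_add hs (Nat.one_le_pow _ _ (by omega))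
      _ = 2 * N ^ a := by ring
      _ ≤ N * N ^ a := Nat.mul_le_mul_right _ hN
      _ = N ^ (a + 1) := by ring
  have h8 : 8 ≤ N ^ 3 := by
    calc 8 = 2 ^ 3 := by norm_num
      _ ≤ N ^ 3 := Nat.pow_le_pow_left hN 3
  have h3 : 2 * N + 1 ≤ N ^ 3 := by
    have : 2 * N + 1 ≤ 4 * N := by omega
    calc 2 * N + 1 ≤ 4 * N := this
      _ ≤ N ^ 2 * N := by nlinarith [hN]
      _ = N ^ 3 := by ring
  have hA : 8 * (s + 1) ^ 7 ≤ N ^ (7 * a + 10) := by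
    calc 8 * (s + 1) ^ 7 ≤ N ^ 3 * (N ^ (a + 1)) ^ 7 :=
          Nat.mul_le_mul h8 (Nat.pow_le_pow_left h1 7)
      _ = N ^ (7 * a + 10) := by ring
  have hB : s ^ 2 * (2 * N + 1) ≤ N ^ (2 * a + 3) := by
    calc s ^ 2 * (2 * N + 1) ≤ (N ^ a) ^ 2 * N ^ 3 :=
          Nat.mul_le_mul (Nat.pow_le_pow_left hs 2) h3
      _ = N ^ (2 * a + 3) := by ring
  have hN1 : 1 ≤ N := by omega
  calc 8 * (s + 1) ^ 7 + s ^ 2 * (2 * N + 1) ≤ N ^ (7 * a + 10) + N ^ (2 * a + 3) :=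
        Nat.add_le_add hA hB
    _ ≤ N ^ (9 * a + 10) + N ^ (9 * a + 10) :=
        Nat.add_le_add (Nat.pow_le_pow_right hN1 (by omega)) (Nat.pow_le_pow_right hN1 (by omega))
    _ = 2 * N ^ (9 * a + 10) := by ring
    _ ≤ N * N ^ (9 * a + 10) := Nat.mul_le_mul_right _ hN
    _ = N ^ (9 * a + 11) := by ring

/-- `2 ≤ C(2n, n)` for `n ≥ 1`. [folklore] -/
theorem two_le_choose_two_mul (hn : 1 ≤ n) : 2 ≤ Nat.choose (2 * n) n := by
  rw [← Nat.centralBinom_eq_two_mul_choose]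
  exact Nat.two_le_centralBinom n hn

/-- **Under Question 6 every affine rank method dies at some size exponent.**  If
`SuccinctHittingSetsForVP ℂ` (the route's rank-2 crux `SuccinctHittingSetsForVP`, stmt-14610)
holds then for every level `a` there are `b, n₀` such that for all `n ≥ n₀` the coefficient
vectors of `SmallCircuits ℂ n b` hit every nonzero polynomial in the coefficient variables of
determinantal complexity `≤ N^a` — i.e. no `r × r` minor of any matrix of affine forms of size
`≤ N^a` (shifted partials, Young flattenings, Ruppert matrices, …) vanishes on the class unless
it is the zero polynomial.  CONDITIONAL on Question 6; the g10 method walls are unconditional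
instances with explicit `b`. [cite: ForbesShpilkaVolk2018, Question 6] -/
theorem isSuccinctHittingSet_detRepr_of_succinct (hyp : SuccinctHittingSetsForVP ℂ) (a : ℕ) :
    ∃ b n₀ : ℕ, ∀ n : ℕ, n₀ ≤ n →
      IsSuccinctHittingSet (degLEMonomials n) (SmallCircuits ℂ n b)
        {D : MvPolynomial ↥(degLEMonomials n) ℂ |
          determinantalComplexity D ≤ Nat.choose (2 * n) n ^ a} := by
  classical
  obtain ⟨b, n₀, h⟩ := hyp (9 * a + 11)
  refine ⟨b, max n₀ 1, fun n hn => ?_⟩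
  have hn₀ : n₀ ≤ n := le_trans (le_max_left _ _) hn
  have hn1 : 1 ≤ n := le_trans (le_max_right _ _) hn
  refine (h n hn₀).mono le_rfl ?_
  intro D hD
  have hN : 2 ≤ Nat.choose (2 * n) n := two_le_choose_two_mul hn1
  have hcard := BarrierLever.NaturalProofsAgainstAllLinearSizes.card_degLEMonomials_le_choose n
  refine mem_distinguishers_of_dc_le hD (le_trans ?_ (size_arith hN (le_refl (Nat.choose (2 * n) n ^ a))))
  have : 2 * Fintype.card ↥(degLEMonomials n) + 1 ≤ 2 * Nat.choose (2 * n) n + 1 := by omega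
  exact Nat.add_le_add_left (Nat.mul_le_mul_left _ this) _

/-- Contrapositive, the form a LINE through a rank method must confront: ONE affine rank method
(matrices `M_n` of affine forms, size parameters `R_n, S_n, r_n` with `8(r_n+1)^7 + r_n²B_n ≤ N^a`)
that, at a FIXED level `a`, has a rank gap on `SmallCircuits ℂ n b` for EVERY `b` (eventually in
`n`, with a largeness witness) refutes Question 6 over `ℂ` = the route's crux
`SuccinctHittingSetsForVP`.  (A gap for ONE `b`, which is all item 8749 asks, is compatible with
Question 6.) [cite: ForbesShpilkaVolk2018, Thm. 4 and Question 6] -/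
theorem not_succinct_of_affineRankMethod {a : ℕ}
    (hgap : ∀ b : ℕ, ∀ n₀ : ℕ, ∃ n, n₀ ≤ n ∧ ∃ (R S r B : ℕ)
      (M : Matrix (Fin R) (Fin S) (MvPolynomial ↥(degLEMonomials n) ℂ)),
      (∀ i j, complexity (M i j) ≤ B) ∧ (∀ i j, (M i j).totalDegree ≤ 1) ∧
      (∀ f ∈ SmallCircuits ℂ n b, (M.map (eval (coeffVector (degLEMonomials n) f))).rank < r) ∧
      (∃ c₀ : ↥(degLEMonomials n) → ℂ, r ≤ (M.map (eval c₀)).rank) ∧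
      8 * (r + 1) ^ 7 + r ^ 2 * B ≤ Nat.choose (2 * n) n ^ a) :
    ¬ SuccinctHittingSetsForVP ℂ := by
  intro hyp
  obtain ⟨b, n₀, h⟩ := hyp a
  obtain ⟨n, hn, R, S, r, B, M, hB, hdeg, hrank, ⟨c₀, hc₀⟩, ha⟩ := hgap b n₀
  exact not_isSuccinctHittingSet_of_rank_lt M hB hdeg hrank c₀ hc₀ ha (h n hn)

end LinearRankTemplate

end Summit.ValiantsHypothesis.ValiantsHypothesis.Theorems.BarrierLeverDefinableEquations
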